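import Literature.MathematicalPhysics.QuantumLattice.KohnLuttingerPairingFormPolar
import HarnessLib

/-!
# The symmetry channels are non-empty: explicit channel states on the square-lattice Fermi curve

Topic `Literature/MathematicalPhysics/QuantumLattice`; continues `KohnLuttingerPairingFormPolar`.
The `sInf` defining `channelInf ε μ U χ` (`KohnLuttinger.lean`) is taken over the set of channel
states `{ψ | IsChannelState ε μ χ ψ}`; this file shows that for `ε = squareDispersion 1 0` and
`-4 < μ < 0` that set is NON-EMPTY in every channel `χ ∈ {A₁g, A₂g, B₁g, B₂g, E}`, by normalising the
lowest lattice harmonics `1`, `sin k₀ sin k₁ (cos k₀ - cos k₁)`, `cos k₀ - cos k₁`, `sin k₀ sin k₁`,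
`sin k₀` (Raghu–Kivelson–Scalapino 2010 §III, eq. (17) and Table I):

* the action of `D₄` on momenta unfolded (`sum_dihedralGroup_four`, `d4Momentum_r_*`,
  `d4Momentum_sr_*`, `rotMomentum_apply_*`, `reflMomentum_apply_*`) — adapted from the refuter's
  crux workfile `Cruxes/CwKLChiralWindow/Disproof.lean` §B;
* `inChannel_B1g_harmonic`, `inChannel_B2g_harmonic`, `inChannel_A2g_harmonic`,
  `inChannel_E_harmonic` — the harmonics transform in their irreps (pointwise identities);
* `exists_isChannelState` — **every channel has a channel state** (the harmonic is bounded, hence in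
  `L²(μ_F)` for the finite measure `μ_F`, and its square has positive `μ_F`-integral: in polar
  coordinates the integrand `w(θ) φ(γθ)²` is continuous, non-negative and positive at an explicit
  angle).

Everything is proved; no definitions. [folklore]
-/

noncomputable section

open Real Set Filter MeasureTheory MeasureTheory.Measure
open scoped Topology ENNReal NNReal BigOperators

namespace Literature.MathematicalPhysics.QuantumLattice

/-! ### The `D₄` action unfolded -/

/-- A sum over `D₄ = DihedralGroup 4` is the sum over the four rotations and the four reflections.
[folklore] -/
theorem sum_dihedralGroup_four (f : DihedralGroup 4 → ℝ) :
    ∑ γ, f γ = (f (.r 0) + f (.r 1) + f (.r 2) + f (.r 3)) +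
      (f (.sr 0) + f (.sr 1) + f (.sr 2) + f (.sr 3)) := by
  -- adapted from Cruxes/CwKLChiralWindow/Disproof.lean §B (refuter cdisprove, 2026-08-16)
  rw [Fintype.sum_equiv DihedralGroup.equivSum f (fun x => f (DihedralGroup.equivSum.symm x))
    (by intro a; rcases a with j | j <;> rfl)]
  rw [Fintype.sum_sum_type]
  simp only [DihedralGroup.equivSum_symm_apply]
  have h4 : ∀ g : ZMod 4 → ℝ, ∑ i, g i = g 0 + g 1 + g 2 + g 3 := fun g => Fin.sum_univ_four g
  rw [h4, h4]

/-- `r⁰ = 1` acts trivially. [folklore] -/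
theorem d4Momentum_r_zero (k : Momentum) : d4Momentum (.r 0) k = k := rfl
/-- `r¹` is the quarter turn. [folklore] -/
theorem d4Momentum_r_one (k : Momentum) : d4Momentum (.r 1) k = rotMomentum k := rfl
/-- `r²`. [folklore] -/
theorem d4Momentum_r_two (k : Momentum) : d4Momentum (.r 2) k = rotMomentum (rotMomentum k) := rfl
/-- `r³`. [folklore] -/
theorem d4Momentum_r_three (k : Momentum) :
    d4Momentum (.r 3) k = rotMomentum (rotMomentum (rotMomentum k)) := rfl
/-- `s`. [folklore] -/
theorem d4Momentum_sr_zero (k : Momentum) : d4Momentum (.sr 0) k = reflMomentum k := rfl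
/-- `s r`. [folklore] -/
theorem d4Momentum_sr_one (k : Momentum) : d4Momentum (.sr 1) k = reflMomentum (rotMomentum k) := rfl
/-- `s r²`. [folklore] -/
theorem d4Momentum_sr_two (k : Momentum) :
    d4Momentum (.sr 2) k = reflMomentum (rotMomentum (rotMomentum k)) := rfl
/-- `s r³`. [folklore] -/
theorem d4Momentum_sr_three (k : Momentum) :
    d4Momentum (.sr 3) k = reflMomentum (rotMomentum (rotMomentum (rotMomentum k))) := rfl

/-- Coordinates of the quarter turn: `(rot k)₀ = -k₁`. [folklore] -/
@[simp] theorem rotMomentum_apply_zero (k : Momentum) : rotMomentum k 0 = -k 1 := by simp [rotMomentum]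
/-- Coordinates of the quarter turn: `(rot k)₁ = k₀`. [folklore] -/
@[simp] theorem rotMomentum_apply_one (k : Momentum) : rotMomentum k 1 = k 0 := by simp [rotMomentum]
/-- Coordinates of the reflection: `(refl k)₀ = k₀`. [folklore] -/
@[simp] theorem reflMomentum_apply_zero (k : Momentum) : reflMomentum k 0 = k 0 := by simp [reflMomentum]
/-- Coordinates of the reflection: `(refl k)₁ = -k₁`. [folklore] -/
@[simp] theorem reflMomentum_apply_one (k : Momentum) : reflMomentum k 1 = -k 1 := by simp [reflMomentum]

/-- The values of `ZMod 4` used by the character table. [folklore] -/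
theorem zmod_four_val : (0 : ZMod 4).val = 0 ∧ (1 : ZMod 4).val = 1 ∧ (2 : ZMod 4).val = 2 ∧
    (3 : ZMod 4).val = 3 := ⟨rfl, rfl, rfl, rfl⟩

/-! ### The lowest harmonics lie in their channels -/

/-- **`cos k₀ - cos k₁ ∈ B₁g`** (`d_{x²-y²}`). [cite: RaghuKivelsonScalapino2010, §III (17)] -/
theorem inChannel_B1g_harmonic : InChannel .B1g (fun k : Momentum => Real.cos (k 0) - Real.cos (k 1)) := by
  funext k
  simp only [d4Project, sum_dihedralGroup_four, d4Momentum_r_zero, d4Momentum_r_one, d4Momentum_r_two,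
    d4Momentum_r_three, d4Momentum_sr_zero, d4Momentum_sr_one, d4Momentum_sr_two, d4Momentum_sr_three,
    D4Irrep.char, D4Irrep.dim, zmod_four_val.1, zmod_four_val.2.1, zmod_four_val.2.2.1,
    zmod_four_val.2.2.2, rotMomentum_apply_zero, rotMomentum_apply_one, reflMomentum_apply_zero,
    reflMomentum_apply_one, Real.cos_neg]
  norm_num
  ring

/-- **`sin k₀ sin k₁ ∈ B₂g`** (`d_{xy}`). [cite: RaghuKivelsonScalapino2010, §III (17)] -/
theorem inChannel_B2g_harmonic : InChannel .B2g (fun k : Momentum => Real.sin (k 0) * Real.sin (k 1)) := by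
  funext k
  simp only [d4Project, sum_dihedralGroup_four, d4Momentum_r_zero, d4Momentum_r_one, d4Momentum_r_two,
    d4Momentum_r_three, d4Momentum_sr_zero, d4Momentum_sr_one, d4Momentum_sr_two, d4Momentum_sr_three,
    D4Irrep.char, D4Irrep.dim, zmod_four_val.1, zmod_four_val.2.1, zmod_four_val.2.2.1,
    zmod_four_val.2.2.2, rotMomentum_apply_zero, rotMomentum_apply_one, reflMomentum_apply_zero,
    reflMomentum_apply_one, Real.sin_neg]
  norm_num
  ring

/-- **`sin k₀ sin k₁ (cos k₀ - cos k₁) ∈ A₂g`** (`g`-wave). [cite: RaghuKivelsonScalapino2010, §III (17)] -/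
theorem inChannel_A2g_harmonic :
    InChannel .A2g (fun k : Momentum => Real.sin (k 0) * Real.sin (k 1) * (Real.cos (k 0) - Real.cos (k 1))) := by
  funext k
  simp only [d4Project, sum_dihedralGroup_four, d4Momentum_r_zero, d4Momentum_r_one, d4Momentum_r_two,
    d4Momentum_r_three, d4Momentum_sr_zero, d4Momentum_sr_one, d4Momentum_sr_two, d4Momentum_sr_three,
    D4Irrep.char, D4Irrep.dim, rotMomentum_apply_zero, rotMomentum_apply_one, reflMomentum_apply_zero,
    reflMomentum_apply_one, Real.sin_neg, Real.cos_neg]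
  norm_num
  ring

/-- **The `E` channel consists exactly of the odd gap functions.** [folklore] -/
theorem inChannel_E_iff_odd (g : Momentum → ℝ) : InChannel .E g ↔ ∀ k, g (-k) = -g k := by
  -- adapted from Cruxes/CwKLChiralWindow/Disproof.lean §B (`e_iff_odd`)
  have rot_rot : ∀ k : Momentum, rotMomentum (rotMomentum k) = -k := fun k => by
    ext i; fin_cases i <;> simp [rotMomentum]
  have ne10 : (1 : ZMod 4) ≠ 0 := by decide
  have ne12 : (1 : ZMod 4) ≠ 2 := by decide
  have ne20 : (2 : ZMod 4) ≠ 0 := by decide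
  have ne30 : (3 : ZMod 4) ≠ 0 := by decide
  have ne32 : (3 : ZMod 4) ≠ 2 := by decide
  constructor
  · intro h k
    have h1 := congrFun h k
    simp only [d4Project, sum_dihedralGroup_four, d4Momentum_r_zero, d4Momentum_r_one, d4Momentum_r_two,
      d4Momentum_r_three, d4Momentum_sr_zero, d4Momentum_sr_one, d4Momentum_sr_two, d4Momentum_sr_three,
      D4Irrep.char, D4Irrep.dim, ne10, ne12, ne20, ne30, ne32, if_false, rot_rot] at h1
    norm_num at h1
    linarith
  · intro hodd
    funext k
    simp only [d4Project, sum_dihedralGroup_four, d4Momentum_r_zero, d4Momentum_r_one, d4Momentum_r_two,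
      d4Momentum_r_three, d4Momentum_sr_zero, d4Momentum_sr_one, d4Momentum_sr_two, d4Momentum_sr_three,
      D4Irrep.char, D4Irrep.dim, ne10, ne12, ne20, ne30, ne32, if_false, rot_rot, hodd]
    norm_num
    ring

/-- **`sin k₀ ∈ E`** (`p`-wave). [cite: RaghuKivelsonScalapino2010, §III (17)] -/
theorem inChannel_E_harmonic : InChannel .E (fun k : Momentum => Real.sin (k 0)) := by
  rw [inChannel_E_iff_odd]
  intro k
  simp [Real.sin_neg]

/-! ### Channel states exist -/

section Exist

variable {μ : ℝ} (hμ₁ : -4 < μ) (hμ₂ : μ < 0)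
include hμ₁ hμ₂

/-- A bounded, measurable, in-channel gap function whose pull-back `w(θ) φ(γθ)²` is positive at some
angle `θ₀ ∈ (-π, π)` normalises to a channel state. [folklore] -/
theorem exists_isChannelState_of_harmonic {χ : D4Irrep} {φ : Momentum → ℝ} (hφc : Continuous φ)
    (C : ℝ) (hC : ∀ k, |φ k| ≤ C) (hch : InChannel χ φ) {θ₀ : ℝ} (hθ₀ : θ₀ ∈ Ioo (-π) π)
    (hpos : φ (fermiPolar μ θ₀) ≠ 0) :
    ∃ ψ, IsChannelState (squareDispersion 1 0) μ χ ψ := by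
  haveI := isFiniteMeasure_fermiCurveMeasure hμ₁ hμ₂
  set ν := fermiCurveMeasure (squareDispersion 1 0) μ with hν
  have hφm : AEStronglyMeasurable φ ν := hφc.aestronglyMeasurable
  have hmem : MemLp φ 2 ν :=
    MemLp.of_bound hφm C (Filter.Eventually.of_forall fun k => by rw [Real.norm_eq_abs]; exact hC k)
  refine ⟨_, isChannelState_normalize hmem hch ?_⟩
  -- positivity of `∫ φ² dμ_F = ∫ w(θ) φ(γθ)² dθ`
  rw [integral_sq_fermiCurveMeasure hμ₁ hμ₂ hφm]
  set f : ℝ → ℝ := fun θ => fermiPolarDOS μ θ * φ (fermiPolar μ θ) ^ 2 with hf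
  have hfc : Continuous f :=
    (continuous_fermiPolarDOS hμ₁ hμ₂).mul ((hφc.comp (continuous_fermiPolar hμ₁ hμ₂)).pow 2)
  have hf0 : ∀ θ, 0 ≤ f θ := fun θ => mul_nonneg (fermiPolarDOS_pos hμ₁ hμ₂ θ).le (sq_nonneg _)
  have hfi : Integrable f (volume.restrict (Ioc (-π) π)) := by
    refine (hfc.continuousOn.integrableOn_compact isCompact_Icc).mono_set Ioc_subset_Icc_self
  rw [integral_pos_iff_support_of_nonneg hf0 hfi]
  -- the support of `f` contains a neighbourhood of `θ₀`
  have hfθ₀ : 0 < f θ₀ := mul_pos (fermiPolarDOS_pos hμ₁ hμ₂ θ₀) (by positivity)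
  have hopen : IsOpen (Function.support f ∩ Ioo (-π) π) := (hfc.isOpen_support).inter isOpen_Ioo
  have hmemθ : θ₀ ∈ Function.support f ∩ Ioo (-π) π := ⟨hfθ₀.ne', hθ₀⟩
  obtain ⟨δ, hδ, hball⟩ := Metric.isOpen_iff.1 hopen θ₀ hmemθ
  rw [Measure.restrict_apply' measurableSet_Ioc]
  refine lt_of_lt_of_le ?_ (measure_mono (show Metric.ball θ₀ δ ⊆ Function.support f ∩ Ioc (-π) π from
    fun θ hθ => ⟨(hball hθ).1, Ioo_subset_Ioc_self (hball hθ).2⟩))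
  rw [Real.volume_ball]
  exact ENNReal.ofReal_pos.2 (by linarith)

/-- **Every symmetry channel contains a channel state** on the square-lattice Fermi curve,
`-4 < μ < 0`: `{ψ | IsChannelState ε μ χ ψ} ≠ ∅` for `ε = squareDispersion 1 0` and every `χ`.
[cite: RaghuKivelsonScalapino2010, §III (17)] -/
theorem exists_isChannelState (χ : D4Irrep) : ∃ ψ, IsChannelState (squareDispersion 1 0) μ χ ψ := by
  have hπ := Real.pi_pos
  have hR0 := bandFermiRadius_pos hμ₁ hμ₂ (0 : ℝ)
  -- the Fermi point on the positive `k₀`-axis: `γ(0) = (u, 0)` with `0 < u < π`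
  have hγ0 : fermiPolar μ 0 0 = bandFermiRadius μ 0 ∧ fermiPolar μ 0 1 = 0 := by
    simp [fermiPolar_apply_zero, fermiPolar_apply_one]
  have hu_lt : bandFermiRadius μ 0 < π := by
    have h := abs_fermiPolar_apply_lt hμ₁ hμ₂ (0 : ℝ) 0
    rw [hγ0.1, abs_of_pos hR0] at h
    exact h
  have h0mem : (0 : ℝ) ∈ Ioo (-π) π := ⟨by linarith, hπ⟩
  cases χ with
  | A1g =>
    exact exists_isChannelState_of_harmonic hμ₁ hμ₂ (φ := fun _ => (1 : ℝ)) continuous_const 1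
      (fun _ => by simp) (inChannel_A1g_const 1) h0mem (by norm_num)
  | B1g =>
    refine exists_isChannelState_of_harmonic hμ₁ hμ₂ (φ := fun k => Real.cos (k 0) - Real.cos (k 1))
      (by fun_prop) 2 (fun k => ?_) inChannel_B1g_harmonic h0mem ?_
    · have h1 := Real.abs_cos_le_one (k 0); have h2 := Real.abs_cos_le_one (k 1)
      calc |Real.cos (k 0) - Real.cos (k 1)| ≤ |Real.cos (k 0)| + |Real.cos (k 1)| := abs_sub _ _
        _ ≤ 2 := by linarith
    · rw [hγ0.1, hγ0.2, Real.cos_zero]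
      have : Real.cos (bandFermiRadius μ 0) < 1 := by
        rw [← Real.cos_zero]
        exact Real.cos_lt_cos_of_nonneg_of_le_pi le_rfl hu_lt.le hR0
      linarith
  | E =>
    refine exists_isChannelState_of_harmonic hμ₁ hμ₂ (φ := fun k => Real.sin (k 0)) (by fun_prop) 1
      (fun k => Real.abs_sin_le_one (k 0)) inChannel_E_harmonic h0mem ?_
    rw [hγ0.1]
    exact (Real.sin_pos_of_pos_of_lt_pi hR0 hu_lt).ne'
  | B2g =>
    -- the diagonal Fermi point `γ(π/4) = (a, a)`, `0 < a < π`
    have hR := bandFermiRadius_pos hμ₁ hμ₂ (π / 4)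
    have ha : fermiPolar μ (π / 4) 0 = fermiPolar μ (π / 4) 1 := by
      rw [fermiPolar_apply_zero, fermiPolar_apply_one, Real.cos_pi_div_four, Real.sin_pi_div_four]
    have ha_pos : 0 < fermiPolar μ (π / 4) 0 := by
      rw [fermiPolar_apply_zero, Real.cos_pi_div_four]; positivity
    have ha_lt : fermiPolar μ (π / 4) 0 < π := by
      have h := abs_fermiPolar_apply_lt hμ₁ hμ₂ (π / 4) 0
      rw [abs_of_pos ha_pos] at h; exact h
    refine exists_isChannelState_of_harmonic hμ₁ hμ₂ (φ := fun k => Real.sin (k 0) * Real.sin (k 1))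
      (by fun_prop) 1 (fun k => ?_) inChannel_B2g_harmonic (θ₀ := π / 4) ⟨by linarith, by linarith⟩ ?_
    · rw [abs_mul]
      have h1 := Real.abs_sin_le_one (k 0); have h2 := Real.abs_sin_le_one (k 1)
      nlinarith [abs_nonneg (Real.sin (k 0)), abs_nonneg (Real.sin (k 1))]
    · rw [← ha]
      have hs := Real.sin_pos_of_pos_of_lt_pi ha_pos ha_lt
      positivity
  | A2g =>
    -- the Fermi point at angle `π/6`: `(u √3/2, u/2)` with `u > 0`, both coordinates in `(0, π)`
    have hR := bandFermiRadius_pos hμ₁ hμ₂ (π / 6)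
    have hx : fermiPolar μ (π / 6) 0 = bandFermiRadius μ (π / 6) * (Real.sqrt 3 / 2) := by
      rw [fermiPolar_apply_zero, Real.cos_pi_div_six]
    have hy : fermiPolar μ (π / 6) 1 = bandFermiRadius μ (π / 6) * (1 / 2) := by
      rw [fermiPolar_apply_one, Real.sin_pi_div_six]
    have hx_pos : 0 < fermiPolar μ (π / 6) 0 := by rw [hx]; positivity
    have hy_pos : 0 < fermiPolar μ (π / 6) 1 := by rw [hy]; positivity
    have hx_lt : fermiPolar μ (π / 6) 0 < π := by
      have h := abs_fermiPolar_apply_lt hμ₁ hμ₂ (π / 6) 0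
      rw [abs_of_pos hx_pos] at h; exact h
    have hy_lt : fermiPolar μ (π / 6) 1 < π := by
      have h := abs_fermiPolar_apply_lt hμ₁ hμ₂ (π / 6) 1
      rw [abs_of_pos hy_pos] at h; exact h
    have hyx : fermiPolar μ (π / 6) 1 < fermiPolar μ (π / 6) 0 := by
      rw [hx, hy]
      have h3 : (1 : ℝ) < Real.sqrt 3 := by
        rw [show (1 : ℝ) = Real.sqrt 1 by rw [Real.sqrt_one]]
        exact Real.sqrt_lt_sqrt (by norm_num) (by norm_num)
      nlinarith
    refine exists_isChannelState_of_harmonic hμ₁ hμ₂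
      (φ := fun k => Real.sin (k 0) * Real.sin (k 1) * (Real.cos (k 0) - Real.cos (k 1)))
      (by fun_prop) 2 (fun k => ?_) inChannel_A2g_harmonic (θ₀ := π / 6) ⟨by linarith, by linarith⟩ ?_
    · rw [abs_mul, abs_mul]
      have h1 := Real.abs_sin_le_one (k 0); have h2 := Real.abs_sin_le_one (k 1)
      have h3 := Real.abs_cos_le_one (k 0); have h4 := Real.abs_cos_le_one (k 1)
      have h5 : |Real.cos (k 0) - Real.cos (k 1)| ≤ 2 :=
        (abs_sub _ _).trans (by linarith)
      have h12 : |Real.sin (k 0)| * |Real.sin (k 1)| ≤ 1 := by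
        nlinarith [abs_nonneg (Real.sin (k 0)), abs_nonneg (Real.sin (k 1))]
      nlinarith [abs_nonneg (Real.sin (k 0)), abs_nonneg (Real.sin (k 1)),
        abs_nonneg (Real.cos (k 0) - Real.cos (k 1)), mul_nonneg (abs_nonneg (Real.sin (k 0))) (abs_nonneg (Real.sin (k 1)))]
    · have hs0 := Real.sin_pos_of_pos_of_lt_pi hx_pos hx_lt
      have hs1 := Real.sin_pos_of_pos_of_lt_pi hy_pos hy_lt
      have hcos : Real.cos (fermiPolar μ (π / 6) 0) < Real.cos (fermiPolar μ (π / 6) 1) :=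
        Real.cos_lt_cos_of_nonneg_of_le_pi hy_pos.le hx_lt.le hyx
      have hne : Real.cos (fermiPolar μ (π / 6) 0) - Real.cos (fermiPolar μ (π / 6) 1) ≠ 0 := by linarith
      exact mul_ne_zero (mul_pos hs0 hs1).ne' hne

end Exist

/-- **The channel-state set is non-empty**, in the form the `sInf` of `channelInf` consumes.
[folklore] -/
theorem nonempty_isChannelState {μ : ℝ} (hμ₁ : -4 < μ) (hμ₂ : μ < 0) (χ : D4Irrep) :
    {ψ | IsChannelState (squareDispersion 1 0) μ χ ψ}.Nonempty :=
  exists_isChannelState hμ₁ hμ₂ χ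

end Literature.MathematicalPhysics.QuantumLattice

end
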